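import Literature.Probability.Percolation.VoronoiArmEstimatesProofs
import Literature.Analysis.FunctionSpaces.PoissonSuperpositionProofs
import Literature.Probability.RandomPlanarGeometry.PoissonGeneralPosition
import Mathlib.Analysis.InnerProductSpace.Basic
import HarnessLib

/-!
# Weak black arms are strict black arms almost surely; `VoronoiAnnealedOneArm` from the RSW input

Topic: Probability / Percolation.  Second proofs file for the named fact `VoronoiAnnealedOneArm`
(`VoronoiArmEstimates.lean`; Tassion 2016, Thm 3 (2)), continuing
`VoronoiArmEstimatesProofs.lean` (the multi-scale argument for STRICT arms).

Tassion's `π₁(s,t)` and the named fact are about WEAK black paths (a point on a face between a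
black and a white cell is black AND white, Tassion 2016 §1.1), while white blocking circuits only
block STRICT black paths; the printed proof's "by duality" uses the almost sure general position of
the Poisson–Voronoi tessellation (Bollobás–Riordan, *Percolation* (2006), Ch. 8 §8.3: a.s. no four
nuclei are cocircular — the tree's `IsPoissonPointProcess.ae_forall_encard_inter_sphere_le_three`).
This file proves that bridge and assembles the reduction of the named fact to the RSW input:

* local structure of the two-colour Voronoi colouring of locally finite nucleus sets `B`, `W`
  (`LocFinite`): nearest nuclei exist and are gapped (`LocFinite.exists_dist_eq_infDist`,
  `LocFinite.exists_gap`); strict blackness near a point is decided by the nearest nuclei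
  (`mem_strictBlackRegion_iff_local`); the strict region accumulates at every black point
  (`exists_mem_strictBlackRegion_near`) and, when no four nuclei are cocircular, is locally
  connected there (`exists_isPreconnected_strictBlackRegion_inter_ball`);
* surgery: a weak black path is shadowed by a strict black path with nearby end-points
  (`exists_strict_joinedIn_of_weak_path`, `exists_strict_of_weak_arm`);
* a.s. goodness of `PB ⊗ PW` (disjoint, nonempty, no four cocircular nuclei: `ae_goodPair`), hence
  `measureReal_weakArm_le_strictArm`;
* `VoronoiAnnealedOneArm_of_annulusBound` — the named fact follows from a scale-uniform bound
  `1 - c` on strict annulus crossings (what Tassion's Theorem 1 + FKG + duality give at `p = 1/2`),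
  by rescaling the mesh, the surgery, and `strictOneArm_decay_of_annulusBound`.

No named fact is introduced; the RSW input remains an explicit hypothesis.

## References
* V. Tassion, *Crossing probabilities for Voronoi percolation*, Ann. Probab. 44 (2016)
  3385–3398, arXiv:1410.6773 — §1.1, §4 (proof of Thm 3 (2)). [Tassion2016]
* B. Bollobás, O. Riordan, *Percolation*, CUP (2006), Ch. 8 §8.3 (a.s. general position).
  [BollobasRiordan2006]
* J. F. C. Kingman, *Poisson Processes* (1993), §2.1–2.2. [Kingman1993]
-/

noncomputable section

namespace Literature.Probability.Percolation

open _root_.MeasureTheory _root_.ProbabilityTheory _root_.Filter _root_.Set _root_.Metric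
open scoped _root_.Topology _root_.ENNReal _root_.NNReal
open Literature.Analysis.FunctionSpaces
open Literature.Topology.PlaneTopology

/-- The configuration-pair space of two-coloured nuclei. -/
local notation "Ω₂" => PointConfig ℂ × PointConfig ℂ

/-! ## Part II.  Weak arms are strict arms almost surely (general position of the nuclei)

Tassion's `π₁(s,t)` and the named fact `VoronoiAnnealedOneArm` are about WEAK black paths (ties
between a black and a white cell are black), while white blocking circuits only block STRICT black
paths.  The bridge is the almost sure general position of the Poisson–Voronoi tessellation
(Bollobás–Riordan 2006, Ch. 8 §8.3: a.s. no four nuclei are cocircular, the tree's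
`IsPoissonPointProcess.ae_forall_encard_inter_sphere_le_three`): then at every black point `w` the
strictly black region is locally connected and accumulates at `w`, so a weak black path can be
shadowed by a strictly black one with nearby end-points (`exists_strict_joinedIn_of_weak_path`). -/

section LocalStructure

open RealInnerProductSpace

/-! ### Locally finite sets: nearest points and gaps -/

/-- A set is *locally finite around every point* if it has finitely many points in every closed
ball. [folklore] -/
def LocFinite (A : Set ℂ) : Prop := ∀ (w : ℂ) (R : ℝ), (A ∩ closedBall w R).Finite

/-- The points of a configuration form a locally finite set. [folklore] -/
theorem locFinite_coe (c : PointConfig ℂ) : LocFinite (c : Set ℂ) := fun w R =>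
  c.finite_inter_isCompact _ (isCompact_closedBall w R)

/-- Locally finite sets are closed under binary union. [folklore] -/
theorem LocFinite.union {A A' : Set ℂ} (hA : LocFinite A) (hA' : LocFinite A') : LocFinite (A ∪ A') :=
  fun w R => by rw [union_inter_distrib_right]; exact (hA w R).union (hA' w R)

/-- Subsets of locally finite sets are locally finite. [folklore] -/
theorem LocFinite.subset {A A' : Set ℂ} (hA : LocFinite A) (h : A' ⊆ A) : LocFinite A' :=
  fun w R => (hA w R).subset (inter_subset_inter_left _ h)

/-- A locally finite set is closed. [folklore] -/
theorem LocFinite.isClosed {A : Set ℂ} (hA : LocFinite A) : IsClosed A := by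
  refine isClosed_of_closure_subset fun p hp => ?_
  have h1 : p ∈ closure (A ∩ closedBall p 1) := by
    rw [Metric.mem_closure_iff] at hp ⊢
    intro ε hε
    obtain ⟨b, hb, hbd⟩ := hp (min ε 1) (by positivity)
    exact ⟨b, ⟨hb, by rw [mem_closedBall, dist_comm]; exact (hbd.trans_le (min_le_right _ _)).le⟩,
      hbd.trans_le (min_le_left _ _)⟩
  rw [(hA p 1).isClosed.closure_eq] at h1
  exact h1.1

/-- **Nearest points exist** in a nonempty locally finite set. [folklore] -/
theorem LocFinite.exists_dist_eq_infDist {A : Set ℂ} (hA : LocFinite A) (hne : A.Nonempty) (w : ℂ) :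
    ∃ a ∈ A, dist w a = infDist w A := by
  set r := infDist w A with hr
  have hF : (A ∩ closedBall w (r + 1)).Finite := hA w (r + 1)
  have hFne : (A ∩ closedBall w (r + 1)).Nonempty := by
    obtain ⟨a, ha, had⟩ := (infDist_lt_iff hne).1 (show infDist w A < r + 1 by linarith)
    exact ⟨a, ha, by rw [mem_closedBall, dist_comm]; exact had.le⟩
  obtain ⟨a, ⟨haA, haB⟩, hmin⟩ := Set.exists_min_image _ (fun b => dist w b) hF hFne
  refine ⟨a, haA, le_antisymm ?_ (infDist_le_dist_of_mem haA)⟩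
  rw [le_infDist hne]
  intro b hb
  by_cases hbB : b ∈ closedBall w (r + 1)
  · exact hmin b ⟨hb, hbB⟩
  · rw [mem_closedBall, dist_comm, not_le] at hbB
    rw [mem_closedBall, dist_comm] at haB
    linarith

/-- **Gap above a level**: in a locally finite set, the distances from `w` exceeding `r` exceed it
by a uniform positive amount. [folklore] -/
theorem LocFinite.exists_gap {A : Set ℂ} (hA : LocFinite A) (w : ℂ) (r : ℝ) :
    ∃ g > 0, ∀ b ∈ A, r < dist w b → r + g ≤ dist w b := by
  set G := {b ∈ A ∩ closedBall w (r + 1) | r < dist w b} with hG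
  have hGf : G.Finite := (hA w (r + 1)).subset (sep_subset _ _)
  rcases G.eq_empty_or_nonempty with hGe | hGne
  · refine ⟨1, one_pos, fun b hb hrb => ?_⟩
    by_contra hlt
    rw [not_le] at hlt
    have : b ∈ G := ⟨⟨hb, by rw [mem_closedBall, dist_comm]; linarith⟩, hrb⟩
    rw [hGe] at this
    exact this
  · obtain ⟨b₀, hb₀, hmin⟩ := Set.exists_min_image _ (fun b => dist w b) hGf hGne
    refine ⟨min 1 (dist w b₀ - r), lt_min one_pos (by linarith [hb₀.2]), fun b hb hrb => ?_⟩
    by_cases hbB : b ∈ closedBall w (r + 1)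
    · have := hmin b ⟨⟨hb, hbB⟩, hrb⟩
      linarith [min_le_right 1 (dist w b₀ - r)]
    · rw [mem_closedBall, dist_comm, not_le] at hbB
      linarith [min_le_left 1 (dist w b₀ - r)]

/-- `infDist` to a union with a nonempty set is at most `infDist` to that set, and is attained on
one of the two pieces: if `infDist w B ≤ infDist w W` then `infDist w (B ∪ W) = infDist w B`.
[folklore] -/
theorem infDist_union_eq_left {B W : Set ℂ} {w : ℂ} (hB : B.Nonempty) (h : infDist w B ≤ infDist w W) :
    infDist w (B ∪ W) = infDist w B := by
  refine le_antisymm (infDist_le_infDist_of_subset subset_union_left hB) ?_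
  rw [le_infDist (hB.mono subset_union_left)]
  rintro b (hb | hb)
  · exact infDist_le_dist_of_mem hb
  · exact h.trans (infDist_le_dist_of_mem hb)

/-! ### Two inner-product facts -/

/-- Squared distance expanded in the real inner product of `ℂ`. [folklore] -/
theorem dist_sq_eq_inner (p x : ℂ) : dist p x ^ 2 = ‖p‖ ^ 2 - 2 * ⟪p, x⟫ + ‖x‖ ^ 2 := by
  rw [dist_eq_norm, norm_sub_sq_real]

/-- **Strict Cauchy–Schwarz on a circle**: two DISTINCT points `x ≠ y` at the same distance `r`
from `w` satisfy `⟪x - w, y - w⟫ < r²`. [folklore] -/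
theorem inner_sub_lt_of_ne {w x y : ℂ} {r : ℝ} (hx : dist x w = r) (hy : dist y w = r) (hxy : x ≠ y) :
    ⟪x - w, y - w⟫ < r ^ 2 := by
  rw [dist_eq_norm] at hx hy
  have h1 : ⟪x - w, y - w⟫ ≤ ‖x - w‖ * ‖y - w‖ := real_inner_le_norm _ _
  rcases h1.lt_or_eq with hlt | heq
  · rw [hx, hy, ← sq] at hlt; exact hlt
  · exfalso
    rw [inner_eq_norm_mul_iff_real, hx, hy] at heq
    rcases eq_or_ne r 0 with hr | hr
    · apply hxy
      rw [hr, norm_eq_zero, sub_eq_zero] at hx hy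
      rw [hx, hy]
    · exact hxy (sub_left_injective (smul_right_injective ℂ hr heq))

/-- **The half-plane of points closer to `x` than to `y`, seen from an equidistant point `w`**: for
`w` with `dist w x = dist w y`, the point `w + η v` (`η > 0`) is closer to `x` than to `y` iff
`0 < ⟪v, x - y⟫` (the quadratic terms cancel). [folklore] -/
theorem dist_add_smul_lt_iff {w x y v : ℂ} (hw : dist w x = dist w y) {η : ℝ} (hη : 0 < η) :
    dist (w + η • v) x < dist (w + η • v) y ↔ 0 < ⟪v, x - y⟫ := by
  rw [← pow_lt_pow_iff_left₀ dist_nonneg dist_nonneg two_ne_zero, dist_sq_eq_inner, dist_sq_eq_inner]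
  have hw2 : dist w x ^ 2 = dist w y ^ 2 := by rw [hw]
  rw [dist_sq_eq_inner, dist_sq_eq_inner] at hw2
  simp only [inner_add_left, real_inner_smul_left, inner_sub_right] at hw2 ⊢
  constructor
  · intro h; nlinarith
  · intro h; nlinarith

/-- The set of points closer to `x` than to `y` is convex (an open half-plane). [folklore] -/
theorem convex_setOf_dist_lt (x y : ℂ) : Convex ℝ {p : ℂ | dist p x < dist p y} := by
  have hset : {p : ℂ | dist p x < dist p y} = {p : ℂ | ⟪p, y - x⟫ * 2 < ‖y‖ ^ 2 - ‖x‖ ^ 2} := by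
    ext p
    simp only [mem_setOf_eq]
    rw [← pow_lt_pow_iff_left₀ dist_nonneg dist_nonneg two_ne_zero, dist_sq_eq_inner,
      dist_sq_eq_inner, inner_sub_right]
    constructor
    · intro h; nlinarith
    · intro h; nlinarith
  rw [hset]
  have hlin : IsLinearMap ℝ fun p : ℂ => ⟪p, y - x⟫ * 2 :=
    { map_add := fun p q => by rw [inner_add_left]; ring
      map_smul := fun c p => by rw [real_inner_smul_left, smul_eq_mul]; ring }
  exact convex_halfSpace_lt hlin _

/-! ### The local picture of the two-colour Voronoi colouring -/

variable {B W : Set ℂ}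

/-- **Local decision of strict blackness (Step B).**  Let `B`, `W` be nonempty and locally
finite, `w` a point, `r` its distance to the nearest nucleus and `g > 0` a gap: every nucleus is
at distance `r` or `≥ r + g` from `w`.  Then a point `w'` with `dist w' w < g/2` is strictly black
iff some black nucleus at distance exactly `r` from `w` is closer to `w'` than every white nucleus
at distance exactly `r` from `w`. [cite: BollobasRiordan2006, Ch. 8 §8.3] -/
theorem mem_strictBlackRegion_iff_local (hBf : LocFinite B) (hWf : LocFinite W) (hB : B.Nonempty)
    (hW : W.Nonempty) {w : ℂ} {g : ℝ}
    (hgap : ∀ b ∈ B ∪ W, dist w b = infDist w (B ∪ W) ∨ infDist w (B ∪ W) + g ≤ dist w b)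
    {w' : ℂ} (hw' : dist w' w < g / 2) :
    w' ∈ strictBlackRegion B W ↔ ∃ x ∈ B, dist w x = infDist w (B ∪ W) ∧
      ∀ y ∈ W, dist w y = infDist w (B ∪ W) → dist w' x < dist w' y := by
  set r := infDist w (B ∪ W) with hr
  -- nuclei at distance `r` from `w` are `< r + g/2` from `w'`, the others are `> r + g/2`
  have hnear : ∀ b, dist w b = r → dist w' b < r + g / 2 := fun b hb => by
    linarith [dist_triangle w' w b]
  have hfar : ∀ b, r + g ≤ dist w b → r + g / 2 < dist w' b := fun b hb => by
    linarith [dist_triangle w w' b, dist_comm w w']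
  constructor
  · intro hS
    rw [mem_strictBlackRegion] at hS
    obtain ⟨x, hxB, hx⟩ := hBf.exists_dist_eq_infDist hB w'
    -- a nucleus at distance `r` from `w`
    obtain ⟨z₀, hz₀, hz₀d⟩ := (hBf.union hWf).exists_dist_eq_infDist (hB.mono subset_union_left) w
    have hz₀' : infDist w' B ≤ dist w' z₀ := by
      rcases hz₀ with h | h
      · exact infDist_le_dist_of_mem h
      · exact hS.le.trans (infDist_le_dist_of_mem h)
    have hxr : dist w x = r := by
      rcases hgap x (Or.inl hxB) with h | h
      · exact h
      · exfalso
        have h1 := hfar x h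
        have h2 := hnear z₀ hz₀d
        linarith
    refine ⟨x, hxB, hxr, fun y hyW hyr => ?_⟩
    calc dist w' x = infDist w' B := hx
      _ < infDist w' W := hS
      _ ≤ dist w' y := infDist_le_dist_of_mem hyW
  · rintro ⟨x, hxB, hxr, hxy⟩
    rw [mem_strictBlackRegion]
    obtain ⟨y, hyW, hy⟩ := hWf.exists_dist_eq_infDist hW w'
    have key : dist w' x < dist w' y := by
      rcases hgap y (Or.inr hyW) with h | h
      · exact hxy y hyW h
      · have h1 := hfar y h
        have h2 := hnear x hxr
        linarith
    calc infDist w' B ≤ dist w' x := infDist_le_dist_of_mem hxB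
      _ < dist w' y := key
      _ = infDist w' W := hy

/-- The data of Step B at a point: distance to the nearest nucleus is attained and gapped. [folklore] -/
theorem exists_gap_union (hBf : LocFinite B) (hWf : LocFinite W) (w : ℂ) :
    ∃ g > 0, ∀ b ∈ B ∪ W, dist w b = infDist w (B ∪ W) ∨ infDist w (B ∪ W) + g ≤ dist w b := by
  obtain ⟨g, hg, hgap⟩ := (hBf.union hWf).exists_gap w (infDist w (B ∪ W))
  refine ⟨g, hg, fun b hb => ?_⟩
  rcases (infDist_le_dist_of_mem hb : infDist w (B ∪ W) ≤ dist w b).eq_or_lt with h | h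
  · exact Or.inl h.symm
  · exact Or.inr (hgap b hb h)

/-- **The strict region accumulates at every black point (Step C).**  If `B ∩ W = ∅`, both
nonempty and locally finite, then every (weakly) black point is a limit of strictly black points:
moving from `w` a little towards its nearest black nucleus `x` makes `x` the unique nearest
nucleus (strict Cauchy–Schwarz on the circle of nearest nuclei). [cite: BollobasRiordan2006, Ch. 8 §8.3] -/
theorem exists_mem_strictBlackRegion_near (hBf : LocFinite B) (hWf : LocFinite W) (hB : B.Nonempty)
    (hW : W.Nonempty) (hdisj : Disjoint B W) {w : ℂ} (hw : w ∈ blackRegion B W) {ε : ℝ} (hε : 0 < ε) :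
    ∃ w' ∈ strictBlackRegion B W, dist w' w < ε := by
  obtain ⟨g, hg, hgap⟩ := exists_gap_union hBf hWf w
  set r := infDist w (B ∪ W) with hr
  rw [mem_blackRegion] at hw
  have hrB : infDist w (B ∪ W) = infDist w B := infDist_union_eq_left hB hw
  obtain ⟨x, hxB, hx⟩ := hBf.exists_dist_eq_infDist hB w
  have hxr : dist w x = r := by rw [hx, ← hrB]
  rcases eq_or_lt_of_le (show (0 : ℝ) ≤ r from infDist_nonneg) with hr0 | hr0
  · -- `w` is a black nucleus, hence strictly black
    refine ⟨w, ?_, by rw [dist_self]; exact hε⟩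
    have hwx : w = x := by rw [← dist_eq_zero, hxr]; exact hr0.symm
    rw [mem_strictBlackRegion, hwx, infDist_zero_of_mem hxB]
    exact (hWf.isClosed.notMem_iff_infDist_pos hW).1 (Disjoint.notMem_of_mem_left hdisj hxB)
  · -- move towards `x`
    set τ : ℝ := min (1 / 2) (min (ε / (2 * r)) (g / (4 * r))) with hτ
    have hτ0 : 0 < τ := by positivity
    have hτ1 : τ < 1 := lt_of_le_of_lt (min_le_left _ _) (by norm_num)
    have hrne : r ≠ 0 := hr0.ne'
    have hτε : τ * r ≤ ε / 2 := by
      calc τ * r ≤ ε / (2 * r) * r := by gcongr; exact le_trans (min_le_right _ _) (min_le_left _ _)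
        _ = ε / 2 := by field_simp
    have hτg : τ * r ≤ g / 4 := by
      calc τ * r ≤ g / (4 * r) * r := by gcongr; exact le_trans (min_le_right _ _) (min_le_right _ _)
        _ = g / 4 := by field_simp
    set w' : ℂ := w + τ • (x - w) with hw'
    have hdw' : dist w' w = τ * r := by
      rw [hw', dist_eq_norm, add_sub_cancel_left, norm_smul, Real.norm_of_nonneg hτ0.le, ← dist_eq_norm,
        dist_comm, hxr]
    refine ⟨w', ?_, by rw [hdw']; linarith⟩
    rw [mem_strictBlackRegion_iff_local hBf hWf hB hW hgap (by rw [hdw']; linarith)]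
    refine ⟨x, hxB, hxr, fun y hyW hyr => ?_⟩
    rw [← hr] at hyr
    have hxy : x ≠ y := fun h => Disjoint.notMem_of_mem_left hdisj hxB (h ▸ hyW)
    have hin : ⟪x - w, y - w⟫ < r ^ 2 :=
      inner_sub_lt_of_ne (by rw [dist_comm, hxr]) (by rw [dist_comm, hyr]) hxy
    -- squared distances
    rw [← pow_lt_pow_iff_left₀ dist_nonneg dist_nonneg two_ne_zero]
    have e1 : dist w' x ^ 2 = (1 - τ) ^ 2 * r ^ 2 := by
      rw [hw', dist_eq_norm, show w + τ • (x - w) - x = (1 - τ) • (w - x) by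
        simp only [sub_smul, one_smul, smul_sub]; abel, norm_smul, Real.norm_of_nonneg (by linarith),
        ← dist_eq_norm, hxr]; ring
    have e2 : dist w' y ^ 2 = r ^ 2 - 2 * τ * ⟪x - w, y - w⟫ + τ ^ 2 * r ^ 2 := by
      rw [hw', dist_eq_norm, show w + τ • (x - w) - y = τ • (x - w) - (y - w) by abel,
        norm_sub_sq_real, norm_smul, Real.norm_of_nonneg hτ0.le, real_inner_smul_left, ← dist_eq_norm,
        ← dist_eq_norm, dist_comm x w, hxr, dist_comm y w, hyr]; ring
    rw [e1, e2]
    nlinarith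

/-- **Local connectedness of the strict region at a black point in general position (Step D).**
If moreover at most three nuclei lie on any circle, then for every black point `w` there is
`ρ₀ > 0` such that `strictBlackRegion B W ∩ ball w ρ` is preconnected for all `0 < ρ ≤ ρ₀`:
with `N_B`, `N_W` the black / white nearest nuclei of `w` (so `#N_B + #N_W ≤ 3`, `N_B ≠ ∅`),
the trace of the strict region on a small ball is the ball (`N_W = ∅`), a union of convex pieces
all containing the points `w + η (w - y)` (`N_W = {y}`), or a single convex piece (`#N_W ≥ 2`
forces `N_B = {x}`).  Four cocircular nuclei coloured `B, W, B, W` would pinch it.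
[cite: BollobasRiordan2006, Ch. 8 §8.3] -/
theorem exists_isPreconnected_strictBlackRegion_inter_ball (hBf : LocFinite B) (hWf : LocFinite W)
    (hB : B.Nonempty) (hW : W.Nonempty) (hdisj : Disjoint B W)
    (hgp : ∀ (c : ℂ) (r : ℝ), ((B ∪ W) ∩ sphere c r).encard ≤ 3) {w : ℂ} (hw : w ∈ blackRegion B W) :
    ∃ ρ₀ > 0, ∀ ρ, 0 < ρ → ρ ≤ ρ₀ → IsPreconnected (strictBlackRegion B W ∩ ball w ρ) := by
  obtain ⟨g, hg, hgap⟩ := exists_gap_union hBf hWf w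
  set r := infDist w (B ∪ W) with hr
  refine ⟨g / 2, by positivity, fun ρ hρ hρg => ?_⟩
  -- the nearest nuclei of each colour
  set NB := {x ∈ B | dist w x = r} with hNB
  set NW := {y ∈ W | dist w y = r} with hNW
  have hwK := hw
  rw [mem_blackRegion] at hw
  have hrB : infDist w (B ∪ W) = infDist w B := infDist_union_eq_left hB hw
  obtain ⟨x₀, hx₀B, hx₀⟩ := hBf.exists_dist_eq_infDist hB w
  have hx₀r : dist w x₀ = r := by rw [hx₀, ← hrB]
  have hx₀N : x₀ ∈ NB := ⟨hx₀B, hx₀r⟩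
  -- the local description of the strict region on the ball
  have hloc : strictBlackRegion B W ∩ ball w ρ =
      {w' | ∃ x ∈ NB, ∀ y ∈ NW, dist w' x < dist w' y} ∩ ball w ρ := by
    ext w'
    simp only [mem_inter_iff, mem_ball, and_congr_left_iff]
    intro hw'
    rw [mem_strictBlackRegion_iff_local hBf hWf hB hW hgap (by linarith)]
    simp only [hNB, hNW, mem_setOf_eq]
    constructor
    · rintro ⟨x, hxB, hxr, h⟩; exact ⟨x, ⟨hxB, hxr⟩, fun y hy => h y hy.1 hy.2⟩
    · rintro ⟨x, ⟨hxB, hxr⟩, h⟩; exact ⟨x, hxB, hxr, fun y hyW hyr => h y ⟨hyW, hyr⟩⟩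
  rw [hloc]
  -- cardinalities: `NB ⊔ NW ⊆ (B ∪ W) ∩ sphere w r`
  have hcard : NB.encard + NW.encard ≤ 3 := by
    have hdNN : Disjoint NB NW := hdisj.mono (sep_subset _ _) (sep_subset _ _)
    rw [← Set.encard_union_eq hdNN]
    refine le_trans (Set.encard_le_encard ?_) (hgp w r)
    rintro b (⟨hb, hbr⟩ | ⟨hb, hbr⟩)
    · exact ⟨Or.inl hb, by rw [mem_sphere, dist_comm]; exact hbr⟩
    · exact ⟨Or.inr hb, by rw [mem_sphere, dist_comm]; exact hbr⟩
  rcases NW.eq_empty_or_nonempty with hNWe | ⟨y, hyN⟩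
  · -- no white nearest nucleus: the whole ball is strictly black
    have : {w' | ∃ x ∈ NB, ∀ y ∈ NW, dist w' x < dist w' y} ∩ ball w ρ = ball w ρ := by
      refine inter_eq_self_of_subset_right fun w' _ => ⟨x₀, hx₀N, fun y hy => ?_⟩
      rw [hNWe] at hy; exact hy.elim
    rw [this]
    exact (convex_ball w ρ).isPreconnected
  · by_cases hNW1 : NW = {y}
    · -- one white nearest nucleus: union over black ones of half-discs with a common point
      have hrpos : 0 < r := by
        rcases eq_or_lt_of_le (show (0 : ℝ) ≤ r from infDist_nonneg) with h0 | h0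
        · exfalso
          have h1 : w = x₀ := by rw [← dist_eq_zero, hx₀r]; exact h0.symm
          have h2 : w = y := by rw [← dist_eq_zero, hyN.2]; exact h0.symm
          exact Disjoint.notMem_of_mem_left hdisj hx₀B (h1.symm.trans h2 ▸ hyN.1)
        · exact h0
      have hset : {w' | ∃ x ∈ NB, ∀ y ∈ NW, dist w' x < dist w' y} ∩ ball w ρ =
          ⋃ x : NB, ({w' | dist w' (x : ℂ) < dist w' y} ∩ ball w ρ) := by
        ext w'
        rw [mem_iUnion]
        simp only [hNW1, mem_singleton_iff, forall_eq, mem_inter_iff, mem_setOf_eq]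
        constructor
        · rintro ⟨⟨x, hx, h⟩, hb⟩; exact ⟨⟨x, hx⟩, h, hb⟩
        · rintro ⟨⟨x, hx⟩, h, hb⟩; exact ⟨⟨x, hx, h⟩, hb⟩
      rw [hset]
      -- the common point `p = w + η (w - y)`
      set η : ℝ := ρ / (2 * r) with hη
      have hη0 : 0 < η := by positivity
      set p : ℂ := w + η • (w - y) with hp
      have hpball : p ∈ ball w ρ := by
        rw [mem_ball, hp, dist_eq_norm, add_sub_cancel_left, norm_smul, Real.norm_of_nonneg hη0.le,
          ← dist_eq_norm, hyN.2, hη]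
        calc ρ / (2 * r) * r = ρ / 2 := by field_simp
          _ < ρ := by linarith
      refine isPreconnected_iUnion ⟨p, ?_⟩ fun x => ?_
      · simp only [mem_iInter]
        rintro ⟨x, hxB, hxr⟩
        refine ⟨?_, hpball⟩
        simp only [mem_setOf_eq]
        rw [hp, dist_add_smul_lt_iff (by rw [hxr, hyN.2]) hη0]
        have hxy : x ≠ y := fun h => Disjoint.notMem_of_mem_left hdisj hxB (h ▸ hyN.1)
        have hin : ⟪x - w, y - w⟫ < r ^ 2 :=
          inner_sub_lt_of_ne (by rw [dist_comm, hxr]) (by rw [dist_comm, hyN.2]) hxy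
        have hyy : ⟪y - w, y - w⟫ = r ^ 2 := by
          rw [real_inner_self_eq_norm_sq, ← dist_eq_norm, dist_comm, hyN.2]
        have : ⟪w - y, x - y⟫ = ⟪y - w, y - w⟫ - ⟪x - w, y - w⟫ := by
          rw [show w - y = -(y - w) by abel, show x - y = (x - w) - (y - w) by abel, inner_neg_left,
            inner_sub_right, real_inner_comm (x - w) (y - w)]; ring
        rw [this, hyy]; linarith
      · exact ((convex_setOf_dist_lt _ _).inter (convex_ball w ρ)).isPreconnected
    · -- at least two white nearest nuclei: then exactly one black one, and the piece is convex
      obtain ⟨y', hy'N, hy'y⟩ : ∃ y' ∈ NW, y' ≠ y := by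
        by_contra h
        simp only [not_exists, not_and, not_not] at h
        exact hNW1 (Set.eq_singleton_iff_unique_mem.2 ⟨hyN, h⟩)
      have hNW2 : (2 : ℕ∞) ≤ NW.encard := by
        rw [← Set.encard_pair hy'y.symm]
        exact Set.encard_le_encard (Set.pair_subset hyN hy'N)
      have hNB1 : NB.encard ≤ 1 := by
        by_contra h
        rw [not_le] at h
        have h2 : (2 : ℕ∞) ≤ NB.encard := Order.add_one_le_of_lt h
        have : (2 : ℕ∞) + 2 ≤ 3 := (add_le_add h2 hNW2).trans hcard
        exact absurd this (by decide)
      have hNBx : NB = {x₀} := by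
        refine Set.eq_singleton_iff_unique_mem.2 ⟨hx₀N, fun x hx => ?_⟩
        exact (Set.encard_le_one_iff.1 hNB1) x x₀ hx hx₀N
      have hset : {w' | ∃ x ∈ NB, ∀ y ∈ NW, dist w' x < dist w' y} ∩ ball w ρ =
          (⋂ y : NW, {w' | dist w' x₀ < dist w' (y : ℂ)}) ∩ ball w ρ := by
        ext w'
        simp only [hNBx, mem_singleton_iff, exists_eq_left, mem_inter_iff, mem_setOf_eq, mem_iInter,
          Subtype.forall]
      rw [hset]
      exact ((convex_iInter fun yy => convex_setOf_dist_lt _ _).inter (convex_ball w ρ)).isPreconnected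

end LocalStructure

section Surgery

variable {B W : Set ℂ}

/-- **Shadowing a weak black path by a strict one (Step E).**  Under the hypotheses of Step D,
every continuous path of (weakly) black points from `a` to `b` can be replaced, for any `ε > 0`,
by a STRICTLY black path between points `ε`-close to `a` and `b`: cover the path by finitely many
balls on which the strict region is connected (Lebesgue number of the cover), and pick strictly
black points near the sample points (Step C). [cite: BollobasRiordan2006, Ch. 8 §8.3] -/
theorem exists_strict_joinedIn_of_weak_path (hBf : LocFinite B) (hWf : LocFinite W) (hB : B.Nonempty)
    (hW : W.Nonempty) (hdisj : Disjoint B W)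
    (hgp : ∀ (c : ℂ) (r : ℝ), ((B ∪ W) ∩ sphere c r).encard ≤ 3) {a b : ℂ} (γ : Path a b)
    (hγ : ∀ τ, γ τ ∈ blackRegion B W) {ε : ℝ} (hε : 0 < ε) :
    ∃ a' b', dist a' a < ε ∧ dist b' b < ε ∧ JoinedIn (strictBlackRegion B W) a' b' := by
  set S := strictBlackRegion B W with hSdef
  -- radii of local connectedness along the path
  choose ρ hρ hconn using fun τ : unitInterval =>
    exists_isPreconnected_strictBlackRegion_inter_ball hBf hWf hB hW hdisj hgp (hγ τ)
  -- Lebesgue number of the cover of `[0,1]` by the preimages of the half-balls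
  obtain ⟨δ, hδ, hleb⟩ := lebesgue_number_lemma_of_metric (isCompact_univ (X := unitInterval))
    (c := fun τ => γ ⁻¹' ball (γ τ) (ρ τ / 2)) (fun τ => isOpen_ball.preimage γ.continuous)
    (fun τ _ => mem_iUnion.2 ⟨τ, by simp [mem_ball, hρ τ]⟩)
  obtain ⟨n₀, hn₀⟩ := exists_nat_one_div_lt hδ
  set n : ℕ := n₀ + 1 with hn
  have hnpos : 0 < n := Nat.succ_pos _
  choose i hi using fun j : Fin (n + 1) => hleb (sampleTime n j) (mem_univ _)
  -- the previous index (`0` for `j = 0`)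
  set prev : Fin (n + 1) → Fin (n + 1) := fun j => ⟨(j : ℕ) - 1, by omega⟩ with hprev
  have hprev_succ : ∀ j : Fin n, prev j.succ = j.castSucc := fun j => by
    ext; simp [hprev]
  -- strictly black points near the sample points
  have hbnd : ∀ j : Fin (n + 1), 0 < min ε (min (ρ (i j) / 2) (ρ (i (prev j)) / 2)) := fun j =>
    lt_min hε (lt_min (half_pos (hρ _)) (half_pos (hρ _)))
  choose s hsS hsd using fun j : Fin (n + 1) =>
    exists_mem_strictBlackRegion_near hBf hWf hB hW hdisj (hγ (sampleTime n j)) (hbnd j)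
  -- consecutive points are joined inside the strict region
  have hstep : ∀ j : Fin n, JoinedIn S (s j.castSucc) (s j.succ) := by
    intro j
    set c : ℂ := γ (i j.castSucc) with hc
    set ρc : ℝ := ρ (i j.castSucc) with hρc
    have h1 : γ (sampleTime n j.castSucc) ∈ ball c (ρc / 2) := hi j.castSucc (mem_ball_self hδ)
    have h2 : γ (sampleTime n j.succ) ∈ ball c (ρc / 2) := by
      refine hi j.castSucc ?_
      rw [mem_ball, dist_comm, dist_sampleTime_succ hnpos]
      exact_mod_cast hn₀
    rw [mem_ball] at h1 h2
    have hs1 : s j.castSucc ∈ ball c ρc := by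
      rw [mem_ball]
      have hd := (hsd j.castSucc).trans_le ((min_le_right _ _).trans (min_le_left _ _))
      linarith [dist_triangle (s j.castSucc) (γ (sampleTime n j.castSucc)) c]
    have hs2 : s j.succ ∈ ball c ρc := by
      rw [mem_ball]
      have hd := (hsd j.succ).trans_le ((min_le_right _ _).trans (min_le_right _ _))
      rw [hprev_succ] at hd
      linarith [dist_triangle (s j.succ) (γ (sampleTime n j.succ)) c]
    have hpc : IsPreconnected (S ∩ ball c ρc) := hconn _ ρc (hρ _) le_rfl
    have hopen : IsOpen (S ∩ ball c ρc) := (isOpen_strictBlackRegion _ _).inter isOpen_ball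
    exact (joinedIn_of_isPreconnected hopen hpc Subset.rfl ⟨hsS _, hs1⟩ ⟨hsS _, hs2⟩).mono
      inter_subset_left
  -- chain them
  have hchain : ∀ k (hk : k < n + 1), JoinedIn S (s 0) (s ⟨k, hk⟩) := by
    intro k hk
    induction k with
    | zero => exact JoinedIn.refl (hsS 0)
    | succ k ih =>
      refine (ih (Nat.lt_of_succ_lt hk)).trans ?_
      have := hstep ⟨k, Nat.lt_of_succ_lt_succ hk⟩
      simpa [Fin.castSucc_mk, Fin.succ_mk] using this
  refine ⟨s 0, s (Fin.last n), ?_, ?_, hchain n (Nat.lt_succ_self n)⟩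
  · have := hsd 0
    rw [sampleTime_zero, γ.source] at this
    exact this.trans_le (min_le_left _ _)
  · have := hsd (Fin.last n)
    rw [sampleTime_last hnpos, γ.target] at this
    exact this.trans_le (min_le_left _ _)

/-- **Weak arms are strict arms with nearby end-points** (deterministic form): for a good pair of
nucleus sets, a weakly black path from `dist a z ≤ s` to `dist b z ≥ t ≥ 2s` yields a strictly
black connection from the open disc of radius `2s` to outside the closed disc of radius `t/2`.
[cite: BollobasRiordan2006, Ch. 8 §8.3] -/
theorem exists_strict_of_weak_arm (hBf : LocFinite B) (hWf : LocFinite W) (hB : B.Nonempty)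
    (hW : W.Nonempty) (hdisj : Disjoint B W)
    (hgp : ∀ (c : ℂ) (r : ℝ), ((B ∪ W) ∩ sphere c r).encard ≤ 3) {z : ℂ} {s t : ℝ} (hs : 0 < s)
    (hst : 2 * s ≤ t) {a b : ℂ} (γ : Path a b) (ha : dist a z ≤ s) (hb : t ≤ dist b z)
    (hγ : ∀ τ, γ τ ∈ blackRegion B W) :
    ∃ a' ∈ ball z (2 * s), ∃ b' ∈ (closedBall z (t / 2))ᶜ, JoinedIn (strictBlackRegion B W) a' b' := by
  obtain ⟨a', b', ha', hb', hJ⟩ := exists_strict_joinedIn_of_weak_path hBf hWf hB hW hdisj hgp γ hγ hs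
  refine ⟨a', ?_, b', ?_, hJ⟩
  · rw [mem_ball]; linarith [dist_triangle a' a z]
  · rw [mem_compl_iff, mem_closedBall, not_le]
    linarith [dist_triangle b b' z, dist_comm b b']

end Surgery

/-! ### Almost sure general position of the two-colour nuclei, and the weak one-arm bound -/

section WeakArms

variable {PB PW : Measure (PointConfig ℂ)}

/-- The configurations for which the surgery applies: disjoint, nonempty nucleus sets with no
four cocircular nuclei. [cite: BollobasRiordan2006, Ch. 8 §8.3] -/
def GoodPair (ω : Ω₂) : Prop :=
  Disjoint ((ω.1 : PointConfig ℂ) : Set ℂ) ((ω.2 : PointConfig ℂ) : Set ℂ) ∧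
    ((ω.1 : PointConfig ℂ) : Set ℂ).Nonempty ∧ ((ω.2 : PointConfig ℂ) : Set ℂ).Nonempty ∧
    ∀ (c : ℂ) (r : ℝ), ((((ω.1 : PointConfig ℂ) : Set ℂ) ∪ ((ω.2 : PointConfig ℂ) : Set ℂ)) ∩
      sphere c r).encard ≤ 3

/-- Under `PB ⊗ PW` the black nuclei are a.s. nonempty (void probabilities of large discs).
[cite: Kingman1993, §2.1] -/
theorem measure_fst_coe_eq_empty (hB : IsPoissonPointProcess (volume : Measure ℂ) PB)
    (hW : IsPoissonPointProcess (volume : Measure ℂ) PW) :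
    (PB.prod PW) {ω : Ω₂ | ((ω.1 : PointConfig ℂ) : Set ℂ) = ∅} = 0 := by
  have hle : ∀ m : ℕ, (PB.prod PW) {ω : Ω₂ | ((ω.1 : PointConfig ℂ) : Set ℂ) = ∅} ≤
      ENNReal.ofReal (Real.exp (-((m : ℝ) ^ 2 * Real.pi))) := by
    intro m
    have hsub : {ω : Ω₂ | ((ω.1 : PointConfig ℂ) : Set ℂ) = ∅} ⊆
        {ω : Ω₂ | (ω.1 : PointConfig ℂ).count (ball 0 m) = 0} := fun ω hω => by
      simp only [mem_setOf_eq] at hω ⊢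
      rw [PointConfig.count_eq_zero_iff', ← PointConfig.coe_eq_carrier, hω, empty_inter]
    refine (measure_mono hsub).trans ?_
    rw [measure_fst_count_eq_zero hB hW measurableSet_ball (volume_ball_ne_top' _ _),
      volume_ball_toReal _ (Nat.cast_nonneg m)]
  have hlim : Tendsto (fun m : ℕ => ENNReal.ofReal (Real.exp (-((m : ℝ) ^ 2 * Real.pi)))) atTop (𝓝 0) := by
    rw [← ENNReal.ofReal_zero]
    refine ENNReal.tendsto_ofReal (Real.tendsto_exp_atBot.comp ?_)
    refine tendsto_neg_atTop_atBot.comp (Tendsto.atTop_mul_const Real.pi_pos ?_)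
    exact (tendsto_pow_atTop two_ne_zero).comp tendsto_natCast_atTop_atTop
  exact le_antisymm (ge_of_tendsto' hlim hle) bot_le

/-- Same for the white nuclei. [cite: Kingman1993, §2.1] -/
theorem measure_snd_coe_eq_empty (hB : IsPoissonPointProcess (volume : Measure ℂ) PB)
    (hW : IsPoissonPointProcess (volume : Measure ℂ) PW) :
    (PB.prod PW) {ω : Ω₂ | ((ω.2 : PointConfig ℂ) : Set ℂ) = ∅} = 0 := by
  have hle : ∀ m : ℕ, (PB.prod PW) {ω : Ω₂ | ((ω.2 : PointConfig ℂ) : Set ℂ) = ∅} ≤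
      ENNReal.ofReal (Real.exp (-((m : ℝ) ^ 2 * Real.pi))) := by
    intro m
    have hsub : {ω : Ω₂ | ((ω.2 : PointConfig ℂ) : Set ℂ) = ∅} ⊆
        {ω : Ω₂ | (ω.2 : PointConfig ℂ).count (ball 0 m) = 0} := fun ω hω => by
      simp only [mem_setOf_eq] at hω ⊢
      rw [PointConfig.count_eq_zero_iff', ← PointConfig.coe_eq_carrier, hω, empty_inter]
    refine (measure_mono hsub).trans ?_
    rw [measure_snd_count_eq_zero hB hW measurableSet_ball (volume_ball_ne_top' _ _),
      volume_ball_toReal _ (Nat.cast_nonneg m)]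
  have hlim : Tendsto (fun m : ℕ => ENNReal.ofReal (Real.exp (-((m : ℝ) ^ 2 * Real.pi)))) atTop (𝓝 0) := by
    rw [← ENNReal.ofReal_zero]
    refine ENNReal.tendsto_ofReal (Real.tendsto_exp_atBot.comp ?_)
    refine tendsto_neg_atTop_atBot.comp (Tendsto.atTop_mul_const Real.pi_pos ?_)
    exact (tendsto_pow_atTop two_ne_zero).comp tendsto_natCast_atTop_atTop
  exact le_antisymm (ge_of_tendsto' hlim hle) bot_le

/-- **Almost every two-colour configuration is good**: the two Poisson processes a.s. share no
point (Kingman's disjointness lemma), are nonempty, and their superposition — a Poisson process of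
intensity `2 · Lebesgue` — a.s. has no four cocircular points
(`IsPoissonPointProcess.ae_forall_encard_inter_sphere_le_three`). [cite: BollobasRiordan2006, Ch. 8 §8.3] -/
theorem ae_goodPair (hB : IsPoissonPointProcess (volume : Measure ℂ) PB)
    (hW : IsPoissonPointProcess (volume : Measure ℂ) PW) : ∀ᵐ ω ∂(PB.prod PW), GoodPair ω := by
  haveI := hB.isProbabilityMeasure; haveI := hW.isProbabilityMeasure
  have h1 : ∀ᵐ ω ∂(PB.prod PW), Disjoint ((ω.1 : PointConfig ℂ) : Set ℂ) ((ω.2 : PointConfig ℂ) : Set ℂ) :=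
    IsPoissonPointProcess.ae_disjoint_carrier hB hW
  have h2 : ∀ᵐ ω ∂(PB.prod PW), ((ω.1 : PointConfig ℂ) : Set ℂ).Nonempty := by
    rw [ae_iff]
    simpa only [not_nonempty_iff_eq_empty] using measure_fst_coe_eq_empty hB hW
  have h3 : ∀ᵐ ω ∂(PB.prod PW), ((ω.2 : PointConfig ℂ) : Set ℂ).Nonempty := by
    rw [ae_iff]
    simpa only [not_nonempty_iff_eq_empty] using measure_snd_coe_eq_empty hB hW
  have h4 : ∀ᵐ ω ∂(PB.prod PW), ∀ (c : ℂ) (r : ℝ),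
      ((((ω.1 : PointConfig ℂ) : Set ℂ) ∪ ((ω.2 : PointConfig ℂ) : Set ℂ)) ∩ sphere c r).encard ≤ 3 := by
    have hQ : IsPoissonPointProcess ((volume : Measure ℂ) + volume)
        ((PB.prod PW).map fun p : Ω₂ => p.1 ∪ p.2) :=
      IsPoissonPointProcess.superposition_holds hB hW
    have hν : ((volume : Measure ℂ) + volume) ≪ volume :=
      (Measure.AbsolutelyContinuous.rfl.add_left Measure.AbsolutelyContinuous.rfl)
    have hae := hQ.ae_forall_encard_inter_sphere_le_three hν
    have hmeas : Measurable fun p : Ω₂ => p.1 ∪ p.2 := PointConfig.measurable_union_holds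
    exact ae_of_ae_map hmeas.aemeasurable hae
  filter_upwards [h1, h2, h3, h4] with ω h1 h2 h3 h4
  exact ⟨h1, h2, h3, h4⟩

/-- **Weak one-arm probabilities are bounded by strict ones.**  For `0 < s` and `t ≥ 2s`, the
(outer) probability of a weakly black path from `dist · z ≤ s` to `dist · z ≥ t` is at most the
probability of the strict arm event `strictArm z (2s) (t/2)` (surgery on the a.s. good
configurations). [cite: Tassion2016, Thm 3 (2)] -/
theorem measureReal_weakArm_le_strictArm (hB : IsPoissonPointProcess (volume : Measure ℂ) PB)
    (hW : IsPoissonPointProcess (volume : Measure ℂ) PW) (z : ℂ) {s t : ℝ} (hs : 0 < s)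
    (hst : 2 * s ≤ t) :
    (PB.prod PW).real {ω : Ω₂ | ∃ (a b : ℂ) (γ : Path a b), dist a z ≤ s ∧ t ≤ dist b z ∧
        ∀ τ, (γ τ : ℂ) ∈ blackRegion ((ω.1 : PointConfig ℂ) : Set ℂ) ((ω.2 : PointConfig ℂ) : Set ℂ)} ≤
      (PB.prod PW).real (strictArm z (2 * s) (t / 2)) := by
  haveI := hB.isProbabilityMeasure; haveI := hW.isProbabilityMeasure
  have hsub : {ω : Ω₂ | ∃ (a b : ℂ) (γ : Path a b), dist a z ≤ s ∧ t ≤ dist b z ∧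
      ∀ τ, (γ τ : ℂ) ∈ blackRegion ((ω.1 : PointConfig ℂ) : Set ℂ) ((ω.2 : PointConfig ℂ) : Set ℂ)} ⊆
      strictArm z (2 * s) (t / 2) ∪ {ω | ¬ GoodPair ω} := by
    rintro ω ⟨a, b, γ, ha, hb, hγ⟩
    by_cases hg : GoodPair ω
    · left
      obtain ⟨hd, hne1, hne2, hgp⟩ := hg
      exact exists_strict_of_weak_arm (locFinite_coe _) (locFinite_coe _) hne1 hne2 hd hgp hs hst γ
        ha hb hγ
    · exact Or.inr hg
  have hnull : (PB.prod PW).real {ω | ¬ GoodPair ω} = 0 := by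
    rw [measureReal_def, ae_iff.1 (ae_goodPair hB hW), ENNReal.toReal_zero]
  calc (PB.prod PW).real _ ≤ (PB.prod PW).real (strictArm z (2 * s) (t / 2) ∪ {ω | ¬ GoodPair ω}) :=
        measureReal_mono hsub (measure_ne_top _ _)
    _ ≤ (PB.prod PW).real (strictArm z (2 * s) (t / 2)) + (PB.prod PW).real {ω | ¬ GoodPair ω} :=
        measureReal_union_le _ _
    _ = (PB.prod PW).real (strictArm z (2 * s) (t / 2)) := by rw [hnull, add_zero]

/-- **`VoronoiAnnealedOneArm` from the RSW input (everything but Tassion's Theorem 1).**  If for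
every pair of independent Poisson processes of Lebesgue intensity the strict annulus crossings
`strictAnnulusCrossing z u` have probability at most `1 - c < 1` at all large scales `u ≥ u₀`,
uniformly in the centre (which is what Tassion's RSW Theorem 1 at `p = 1/2`, combined with FKG and
duality, provides), then the annealed mesh-uniform one-arm bound `VoronoiAnnealedOneArm` holds:
rescale the mesh `δ` to `1` (`w ↦ w/δ`, a set identity), pass from weak to strict arms almost
surely (`measureReal_weakArm_le_strictArm`), and apply the multi-scale estimate
`strictOneArm_decay_of_annulusBound`. [cite: Tassion2016, §4 (proof of Thm 3 (2))] -/
theorem VoronoiAnnealedOneArm_of_annulusBound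
    (hann : ∀ (PB PW : Measure (PointConfig ℂ)), IsPoissonPointProcess (volume : Measure ℂ) PB →
      IsPoissonPointProcess (volume : Measure ℂ) PW → ∃ c u₀ : ℝ, 0 < c ∧ 0 < u₀ ∧
        ∀ u, u₀ ≤ u → ∀ z, (PB.prod PW).real (strictAnnulusCrossing z u) ≤ 1 - c) :
    VoronoiAnnealedOneArm := by
  intro PB PW hB hW
  haveI := hB.isProbabilityMeasure; haveI := hW.isProbabilityMeasure
  obtain ⟨c, u₀, hc, hu₀, hcu⟩ := hann PB PW hB hW
  obtain ⟨C, η, hη, hdec⟩ := strictOneArm_decay_of_annulusBound hB hW hc hu₀ hcu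
  refine ⟨max C 1 * 4 ^ η, η, hη, fun δ ε ρ hδ hδε hερ z => ?_⟩
  have hε : 0 < ε := hδ.trans_le hδε
  have hρ : 0 < ρ := hε.trans_le hερ
  set μ := PB.prod PW with hμ
  -- rescale to mesh `1`
  set s : ℝ := ε / δ with hs
  set t : ℝ := ρ / δ with ht
  have hs1 : 1 ≤ s := by rwa [hs, le_div_iff₀ hδ, one_mul]
  have hst : s ≤ t := by rw [hs, ht]; gcongr
  have hts : ε / ρ = s / t := by
    rw [hs, ht, div_div_div_cancel_right₀ hδ.ne']
  have hscale : {cfg : Ω₂ | ∃ (a b : ℂ) (γ : Path a b), dist a z ≤ ε ∧ ρ ≤ dist b z ∧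
      ∀ τ, (γ τ : ℂ) / (δ : ℂ) ∈ blackRegion ((cfg.1 : PointConfig ℂ) : Set ℂ) ((cfg.2 : PointConfig ℂ) : Set ℂ)} ⊆
      {cfg : Ω₂ | ∃ (a b : ℂ) (γ : Path a b), dist a (z / δ) ≤ s ∧ t ≤ dist b (z / δ) ∧
      ∀ τ, (γ τ : ℂ) ∈ blackRegion ((cfg.1 : PointConfig ℂ) : Set ℂ) ((cfg.2 : PointConfig ℂ) : Set ℂ)} := by
    rintro cfg ⟨a, b, γ, ha, hb, hγ⟩
    have hcont : Continuous fun w : ℂ => w / (δ : ℂ) := continuous_id.div_const _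
    have hdist : ∀ p q : ℂ, dist (p / (δ : ℂ)) (q / (δ : ℂ)) = dist p q / δ := fun p q => by
      rw [dist_eq_norm, ← sub_div, norm_div, Complex.norm_real, Real.norm_of_nonneg hδ.le, ← dist_eq_norm]
    refine ⟨a / δ, b / δ, γ.map hcont, ?_, ?_, fun τ => ?_⟩
    · rw [hdist, hs]; gcongr
    · rw [hdist, ht]; gcongr
    · simpa using hγ τ
  have hbound : μ.real {cfg : Ω₂ | ∃ (a b : ℂ) (γ : Path a b), dist a (z / δ) ≤ s ∧ t ≤ dist b (z / δ) ∧
      ∀ τ, (γ τ : ℂ) ∈ blackRegion ((cfg.1 : PointConfig ℂ) : Set ℂ) ((cfg.2 : PointConfig ℂ) : Set ℂ)} ≤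
      max C 1 * 4 ^ η * (s / t) ^ η := by
    have h4η : (0 : ℝ) < 4 ^ η := Real.rpow_pos_of_pos (by norm_num) η
    have hst0 : 0 < s / t := by positivity
    rcases le_or_gt (4 * s) t with h4 | h4
    · -- far apart: surgery + strict decay
      calc μ.real _ ≤ μ.real (strictArm (z / δ) (2 * s) (t / 2)) :=
            measureReal_weakArm_le_strictArm hB hW _ (by positivity) (by linarith)
        _ ≤ C * (2 * s / (t / 2)) ^ η := hdec (2 * s) (t / 2) (by linarith) (by linarith) _
        _ = C * 4 ^ η * (s / t) ^ η := by
            rw [show 2 * s / (t / 2) = 4 * (s / t) by field_simp; ring,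
              Real.mul_rpow (by norm_num) hst0.le, mul_assoc]
        _ ≤ max C 1 * 4 ^ η * (s / t) ^ η := by gcongr; exact le_max_left _ _
    · -- close radii: the bound exceeds `1`
      have h1 : (1 : ℝ) ≤ 4 ^ η * (s / t) ^ η := by
        rw [← Real.mul_rpow (by norm_num) hst0.le]
        refine Real.one_le_rpow ?_ hη.le
        rw [mul_div_assoc', le_div_iff₀ (by positivity)]; linarith
      calc μ.real _ ≤ 1 := measureReal_le_one
        _ ≤ 4 ^ η * (s / t) ^ η := h1
        _ ≤ max C 1 * 4 ^ η * (s / t) ^ η := by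
            rw [mul_assoc]
            exact le_mul_of_one_le_left (by positivity) (le_max_right _ _)
  rw [hts]
  exact (measureReal_mono hscale (measure_ne_top _ _)).trans hbound

end WeakArms

end Literature.Probability.Percolation
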